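import Summits.QuantumFields.YangMills.Theorems.UnitScaleTiltProp7OneFormGreenKernelRowOfLift
import Summits.QuantumFields.YangMills.Theorems.UnitScaleTiltProp7LiftOfRSEqPrintProjector
import HarnessLib

/-!
# Route `UnitScaleTilt`, crux K1 «MinimiserStabilityRegPr» (stmt-QuantumFields-19200), EX one-form storey, (P-1FA) FILE A2h —
# **THE (C_V) LETTER HOLDS WITH A COUPLING-FREE CONSTANT: THE REMAINDER `V := Δ_a − (Kato part)` IS BOUNDED BELOW IN FORM, K-UNIFORMLY AND UNIFORMLY IN THE
# COUPLING `a ≥ 0`, AT EVERY LIFTED PRINTED-REGULAR BACKGROUND** (the coupling-free edition of (K2-DISCHARGE) ✓`Prop7OneFormGreenKernelRowOfLift.hVlow_of_lift`)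

Cell `ym3-torus` (HUMAN RULING D-0037; rung R3 = SU(2) YM₃ on T³ — NOT d = 4, NOT infinite volume, NOT a mass gap, NOT Clay).  Width seat `ym3-torus-px21` g14, supplier of the
A2 letters of the chair's one-form Agmon storey (A2a–A2g ✓p765501 … ✓p767241, hk_Q ✓p766516 ∕ ✓p767523).  THEOREMS ONLY (0 `def`, 0 `sorry`, default heartbeats); def-free,
`--supports stmt-QuantumFields-19200 --as helper`, count-neutral.

WHY.  The `hVlow` binder `−C_V‖v‖² ≤ re⟪v, Δ_a v⟫ − Σ_μ ‖D_{U₀}(toL2S X_μ)‖²` (`v = toL2 X`) of A4b ✓`Prop7OneFormBlockDecayAll.blockDecay_allBlocks_of_letters` and of (K2)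
✓`Prop7OneFormGreenKernelRow.kernelRow_GT_DeltaEtaSlot` ∕ ✓`Prop7OneFormPointwiseDecayRate.kernelRow_GT_DeltaEtaSlot_rate` is, by A1 ✓`Prop7OneFormGarding.katoEnergy_le`, the sum of
two displayed letters: the LOCAL one `hloc : |re⟪v, toL2(η⁻²(Δ′₁ − 𝒦)X)⟫| ≤ C_loc‖v‖²` — discharged at `RegPr` by A2d ✓`Prop7OneFormAgmonLocal.abs_re_inner_local_le`
(`C_loc = 32√2·ε₀·d·6^d`) — and the COMPLEMENTARY-PROJECTOR one `hP : ‖D*v − R_S D*v‖² ≤ C_P‖v‖²`.  (K2-DISCHARGE) D1 ✓`Prop7OneFormGreenKernelRowOfLift.hVlow_of_lift` (px16 g13,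
p768082, concurrent with this pen) supplies `hP` on the LIFT LOCUS from the LOD line — Pythagoras ✓`norm_sq_sub_RS_eq` ∘ `R_S(U₀) = projR (covLapSite U₀) Q″` for the `Q″` of record
(✓`exists_intertwiner_of_regPr` ∘ ✓`RS_eq_projR_iff_lift`) ∘ the `H¹` absorption of the divergence ✓`Prop7DivergenceAbsorptionOfRegPr.normSq_DstarL2_le_normSq_projR_add_of_regPr'` —
with the MASSIVE WEIGHT OF THE GRAM BOUND TIED TO THE COUPLING `a` of `Δ_a`: its `C_P = (m_B(c₁′, a)²·a)⁻¹` grows linearly in `a`, and the (γ) door's coupling floor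
`a ≥ a₀(c₀∕cB)ℓ³` grows with `ℓ = L^{K−n}` (px16's own flag (F1)).  THIS FILE decouples the two: ✓`normSq_DstarL2_le_normSq_projR_add_of_regPr'` holds for ANY auxiliary massive
weight `a′ > 0` and coarse weight `c₁′ > 0` — they are NOT the coupling (the coupling enters `katoEnergy_le` only through `−a‖Q_kv‖² ≤ 0`, i.e. needs `0 ≤ a` and nothing else).
The choice `c₁′ := c₀ℓ³`, `a′ := 600·(27∕4)⁶` makes `m_B` an absolute number and **`C_P = (33∕8)²·600·(27∕4)⁶`** — K-free, L-free, background-free, COUPLING-FREE — so the window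
`0 < Θ_r = (1−ε)γ − εC_V − 3r²e^{2r}(1+1∕ε) − θ_V` of (K2)∕D1 can be met with `(ε, r)` depending on `γ` alone: the decay rate `min r ¼ ∕ 2` of D1∕D2 stays K-uniform.

WHAT IS PROVED (ns `Summit.QuantumFields.YangMills.Theorems.Prop7OneFormRemainderFloorOfLift`; member `F`, `n < K`, `ℓ = L^{K−n}`; the `Lift` hypothesis is the text of
✓`RS_eq_projR_iff_lift` ∕ ✓`Prop7OneFormCoerciveHolds` VERBATIM).
* §1 ★★ `normSq_DstarL2_sub_RS_le_of_lift'` (the `hP` letter of A1 ✓`katoEnergy_le` under `Lift`, the two AUXILIARY weights `c₁′, a′` free and independent of the coupling) ·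
  ★★ `normSq_DstarL2_sub_RS_le_of_lift` (`hP` with the absolute `C_P = (33∕8)²·600·(27∕4)⁶`).
* §2 ★★ `hVlow_aux_of_lift` (the `hVlow` binder with `C_V := C_loc + (m_B(c₁′,a′)²a′)⁻¹`, auxiliary weights free, coupling `0 ≤ a` free — generalises D1's `hVlow_of_lift`, which is the
  case `a′ := a`) · ★★★ `hVlow_abs_of_lift` — **the `hVlow` binder of A4b ∕ (K2) ∕ RATE VERBATIM at the slot of record `Δx := DeltaEtaSlot`**, letter-free under `RegPr F n K ε₀ U₀`
  (`0 < ε₀`, `10¹²L³ε₀ ≤ 1`, `n < K`), `0 ≤ a` and `Lift`, with the ABSOLUTE **`C_V := 32√2·ε₀·(d·6^d) + (33∕8)²·600·(27∕4)⁶`**.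
HONEST SCOPE.  Compositions of landed theorems (Pythagoras is D1's ✓`norm_sq_sub_RS_eq`, imported, not restated); the constant `C_P` is the LOD line's Gram constant at one admissible
choice of auxiliary weights, not an optimised one.  CONDITIONAL on `Lift` (discharged at the junction by ✓`hIrrLift_of_record`, like every EX row); nothing of the ten EX rows, `hT`,
(3.42)∕(3.46) for print's `G`∕`H`, EX or the crux is proved here; no summit is proved by a helper.

References: T. Bałaban, *Propagators for lattice gauge theories in a background field*, CMP **99** (1985) 389–434 [Balaban1985BackgroundPropagators] ((3.21)–(3.27) pp.394–395,
Thm 3.11 p.416); *The variational problem …*, CMP **102** (1985) 277–309 [Balaban1985Variational] ((134)–(136) p.298); *Averaging operations …*, CMP **98** (1985) 17–51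
[Balaban1985Averaging] ((97) p.32).
-/

set_option autoImplicit false

noncomputable section

open scoped BigOperators Matrix.Norms.L2Operator InnerProductSpace ComplexConjugate

namespace Summit.QuantumFields.YangMills.Theorems.Prop7OneFormRemainderFloorOfLift

open Literature.MathematicalPhysics.QuantumFieldTheory.Balaban1983to89
open Literature.MathematicalPhysics.QuantumFieldTheory.Balaban1983to89.T3ContinuumYM3Torus
open T4Continuum BlockAveraging
open BlockAveraging (Idx)
open B7Prop1Explicit (disp)
open B10Eq27TorusAxialLog (holT transl)
open B7TransferAnalyticMean (meanCLM)
open B15DeterminingSets (embIter)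
open Summit.QuantumFields.YangMills.Theorems.Prop8Chart (emlIterU)
open T3SectALandauChart (eta eta_pos bgUnits formComp)
open T3PrintedRegularMinimiser (RegPr)
open B9TorusCalculus (torusT)
open B9Eq310Hermitian (deltaPrimeOp)
open B11Eq135Weitzenbock (curvOp)
open B11Eq103H1Complex (SiteL2K BondL2K projR)
open Summit.QuantumFields.YangMills.Theorems.Prop7SectET3Transport (periodsT3)
open Summit.QuantumFields.YangMills.Theorems.Prop7SectET3HilbertLetters (W₂ toL2 toL2S DL2 DstarL2 covLapSite)
open Summit.QuantumFields.YangMills.Theorems.Prop7SectET3WilsonHessian (DeltaEta DeltaEtaSlot)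
open Summit.QuantumFields.YangMills.Theorems.Prop7SectET3GaugeProjector (NS RS)
open Summit.QuantumFields.YangMills.Theorems.Prop7SectET3CurvedPropagators (laplaceA Qk)
open Summit.QuantumFields.YangMills.Theorems.Prop7LiftOfRSEqPrintProjector (RS_eq_projR_iff_lift)
open Summit.QuantumFields.YangMills.Theorems.Prop7NSIntertwinerOfRecord (exists_intertwiner_of_regPr)
open Summit.QuantumFields.YangMills.Theorems.Prop7DivergenceAbsorptionOfRegPr (normSq_DstarL2_le_normSq_projR_add_of_regPr')
open Summit.QuantumFields.YangMills.Theorems.Prop7OneFormGarding (katoEnergy_le)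
open Summit.QuantumFields.YangMills.Theorems.Prop7OneFormAgmonLocal (abs_re_inner_local_le)
open Summit.QuantumFields.YangMills.Theorems.Prop7OneFormGreenKernelRowOfLift (norm_sq_sub_RS_eq)

variable (F : T3Family) {n K : ℕ} (h : n ≤ K) (c₀ cB : ℝ) [Fact (0 < c₀)] [Fact (0 < cB)] {a : ℝ}

/-! ## §1 The complementary-projector letter `hP` under `Lift`, auxiliary weights decoupled from the coupling -/

omit [Fact (0 < cB)] in
/-- ★★ **THE `hP` LETTER OF A1 ✓`katoEnergy_le` HOLDS ON THE LIFT LOCUS, auxiliary weights free**: at `RegPr F n K ε₀ U₀` (`0 < ε₀`, `10¹²L³ε₀ ≤ 1`, `n < K`) with `Lift`, for every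
coarse weight `c₁′ > 0` and auxiliary massive weight `a′ > 0` (NOT the coupling of `Δ_a`), and every vector field `A`,
`‖D*A − R_S D*A‖² ≤ (m_B(c₁′, a′)²·a′)⁻¹·‖A‖²` — Pythagoras ∘ `R_S = projR (covLapSite U₀) Q″` (the `Q″` of record, under Lift) ∘ the `H¹` absorption of the divergence.
[cite: Balaban1985BackgroundPropagators, (3.21)–(3.27) pp.394–395, Thm 3.11 p.416; Balaban1985Averaging, (97) p.32] -/
theorem normSq_DstarL2_sub_RS_le_of_lift' (hnK : n < K) {ε₀ : ℝ} (hε₀ : 0 < ε₀) (hWε : 10 ^ 12 * (F.L : ℝ) ^ 3 * ε₀ ≤ 1)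
    (U₀ : GaugeField (F.P K) 0 (Matrix.specialUnitaryGroup (Fin 2) ℂ)) (hreg : RegPr F n K ε₀ U₀)
    (hlift : ∀ cf : Site (F.P K) (K - n) → Matrix (Fin 2) (Fin 2) ℂ,
        (∀ e : PBond (F.P K) (K - n), cf e.src = ((emlIterU (K - n) (bgUnits F K U₀) e : (Matrix (Fin 2) (Fin 2) ℂ)ˣ) : Matrix (Fin 2) (Fin 2) ℂ) * cf e.tgt *
          (((emlIterU (K - n) (bgUnits F K U₀) e)⁻¹ : (Matrix (Fin 2) (Fin 2) ℂ)ˣ) : Matrix (Fin 2) (Fin 2) ℂ)) →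
        ∃ l₀ : Site (F.P K) 0 → Matrix (Fin 2) (Fin 2) ℂ,
          (∀ b : PBond (F.P K) 0, l₀ b.src = ((bgUnits F K U₀ b : (Matrix (Fin 2) (Fin 2) ℂ)ˣ) : Matrix (Fin 2) (Fin 2) ℂ) * l₀ b.tgt * (((bgUnits F K U₀ b)⁻¹ : (Matrix (Fin 2) (Fin 2) ℂ)ˣ) : Matrix (Fin 2) (Fin 2) ℂ)) ∧
          ∀ y : Site (F.P K) (K - n), l₀ (embIter (K - n) y) = cf y)
    (c₁' : ℝ) (hc₁' : 0 < c₁') {a' : ℝ} (ha' : 0 < a') (A : BondL2K ℂ 3 (periodsT3 F K) c₀ W₂) :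
    ‖DstarL2 F n K c₀ U₀ A - RS F n K h c₀ cB U₀ (DstarL2 F n K c₀ U₀ A)‖ ^ 2
      ≤ ((2 / ((1 + (25 / 8) * (c₁' * ((((F.P K).L : ℝ) ^ (F.P K).d) ^ (K - n))⁻¹ / c₀)) * (600 * (27 / 4 : ℝ) ^ 6 * (c₀ * ((F.L : ℝ) ^ 3) ^ (K - n) / c₁') + a'))) ^ 2 * a')⁻¹
        * ‖A‖ ^ 2 := by
  obtain ⟨Q'', _D', _hint, _hD', htop, hseq, hker⟩ := exists_intertwiner_of_regPr (F := F) (c₀ := c₀) hnK.le cB hε₀ hWε U₀ hreg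
  have hRS : RS F n K h c₀ cB U₀ = projR (covLapSite F n K c₀ U₀) Q'' :=
    (RS_eq_projR_iff_lift (F := F) h cB hε₀ hWε U₀ hreg Q'' htop hker).2 hlift
  have hε7 : 10 ^ 7 * (F.L : ℝ) ^ 3 * ε₀ ≤ 1 := by
    have h1 : 10 ^ 7 * (F.L : ℝ) ^ 3 * ε₀ ≤ 10 ^ 12 * (F.L : ℝ) ^ 3 * ε₀ :=
      mul_le_mul_of_nonneg_right (mul_le_mul_of_nonneg_right (by norm_num) (by positivity)) hε₀.le
    exact h1.trans hWε
  have key := normSq_DstarL2_le_normSq_projR_add_of_regPr' F hε₀ hε7 U₀ hreg Q'' hseq hnK c₁' hc₁' ha' A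
  rw [norm_sq_sub_RS_eq, hRS]
  linarith

omit [Fact (0 < cB)] in
/-- ★★ **THE `hP` LETTER WITH AN ABSOLUTE CONSTANT**: under the same antecedents, `‖D*A − R_S D*A‖² ≤ (33∕8)²·600·(27∕4)⁶ · ‖A‖²` for every `A` — the choice `c₁′ := c₀ℓ³`,
`a′ := 600·(27∕4)⁶` of the auxiliary weights (`d = 3`, `ℓ = L^{K−n}`), K-free, L-free, coupling-free.
[cite: Balaban1985BackgroundPropagators, (3.21)–(3.27) pp.394–395, Thm 3.11 p.416; Balaban1985Averaging, (97) p.32] -/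
theorem normSq_DstarL2_sub_RS_le_of_lift (hnK : n < K) {ε₀ : ℝ} (hε₀ : 0 < ε₀) (hWε : 10 ^ 12 * (F.L : ℝ) ^ 3 * ε₀ ≤ 1)
    (U₀ : GaugeField (F.P K) 0 (Matrix.specialUnitaryGroup (Fin 2) ℂ)) (hreg : RegPr F n K ε₀ U₀)
    (hlift : ∀ cf : Site (F.P K) (K - n) → Matrix (Fin 2) (Fin 2) ℂ,
        (∀ e : PBond (F.P K) (K - n), cf e.src = ((emlIterU (K - n) (bgUnits F K U₀) e : (Matrix (Fin 2) (Fin 2) ℂ)ˣ) : Matrix (Fin 2) (Fin 2) ℂ) * cf e.tgt *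
          (((emlIterU (K - n) (bgUnits F K U₀) e)⁻¹ : (Matrix (Fin 2) (Fin 2) ℂ)ˣ) : Matrix (Fin 2) (Fin 2) ℂ)) →
        ∃ l₀ : Site (F.P K) 0 → Matrix (Fin 2) (Fin 2) ℂ,
          (∀ b : PBond (F.P K) 0, l₀ b.src = ((bgUnits F K U₀ b : (Matrix (Fin 2) (Fin 2) ℂ)ˣ) : Matrix (Fin 2) (Fin 2) ℂ) * l₀ b.tgt * (((bgUnits F K U₀ b)⁻¹ : (Matrix (Fin 2) (Fin 2) ℂ)ˣ) : Matrix (Fin 2) (Fin 2) ℂ)) ∧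
          ∀ y : Site (F.P K) (K - n), l₀ (embIter (K - n) y) = cf y)
    (A : BondL2K ℂ 3 (periodsT3 F K) c₀ W₂) :
    ‖DstarL2 F n K c₀ U₀ A - RS F n K h c₀ cB U₀ (DstarL2 F n K c₀ U₀ A)‖ ^ 2 ≤ (33 / 8 : ℝ) ^ 2 * (600 * (27 / 4 : ℝ) ^ 6) * ‖A‖ ^ 2 := by
  have hc₀ : 0 < c₀ := Fact.out
  have hL : (0 : ℝ) < (F.L : ℝ) := by exact_mod_cast lt_trans zero_lt_one F.hL.2
  have hℓ : (0 : ℝ) < ((F.L : ℝ) ^ 3) ^ (K - n) := by positivity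
  have hN : (0 : ℝ) < 600 * (27 / 4 : ℝ) ^ 6 := by positivity
  have h1 := normSq_DstarL2_sub_RS_le_of_lift' F h c₀ cB hnK hε₀ hWε U₀ hreg hlift (c₀ * ((F.L : ℝ) ^ 3) ^ (K - n)) (by positivity) hN A
  have hPL : (F.P K).L = F.L := rfl
  rw [T3Family.P_d, hPL] at h1
  refine h1.trans (le_of_eq ?_)
  have hc₀' : c₀ ≠ 0 := hc₀.ne'
  have hℓ' : ((F.L : ℝ) ^ 3) ^ (K - n) ≠ 0 := hℓ.ne'
  congr 1
  field_simp
  ring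

/-! ## §2 The (C_V) letter `hVlow` of A4b ∕ (K2) at the slot of record, letter-free under `Lift` -/

/-- ★★ **(C_V) HOLDS, auxiliary weights free and independent of the coupling** (D1 ✓`hVlow_of_lift` is the case `a′ := a`): at `RegPr F n K ε₀ U₀` (`0 < ε₀`, `10¹²L³ε₀ ≤ 1`, `n < K`), `0 ≤ a`, `Lift`, for all `c₁′, a′ > 0` and every bond field `X`,
`−((C_loc + (m_B²a′)⁻¹)·‖toL2 X‖²) ≤ re⟪toL2 X, Δ_a(DeltaEtaSlot)(U₀) toL2 X⟫ − Σ_μ ‖D_{U₀}(toL2S X_μ)‖²`, `C_loc = 32√2·ε₀·(d·6^d)` — A1 ✓`katoEnergy_le` at the slot of record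
(slot term `= 0` by ✓`DeltaEtaSlot_apply`, `−a‖Q_kv‖² ≤ 0`) with `hloc` ⟸ A2d ✓`abs_re_inner_local_le` and `hP` ⟸ §1.
[cite: Balaban1985Variational, (134)–(136) p.298; Balaban1985BackgroundPropagators, (3.26) p.395, Thm 3.11 p.416] -/
theorem hVlow_aux_of_lift (hnK : n < K) {ε₀ : ℝ} (hε₀ : 0 < ε₀) (hWε : 10 ^ 12 * (F.L : ℝ) ^ 3 * ε₀ ≤ 1)
    (U₀ : GaugeField (F.P K) 0 (Matrix.specialUnitaryGroup (Fin 2) ℂ)) (hreg : RegPr F n K ε₀ U₀) (ha : 0 ≤ a)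
    (hlift : ∀ cf : Site (F.P K) (K - n) → Matrix (Fin 2) (Fin 2) ℂ,
        (∀ e : PBond (F.P K) (K - n), cf e.src = ((emlIterU (K - n) (bgUnits F K U₀) e : (Matrix (Fin 2) (Fin 2) ℂ)ˣ) : Matrix (Fin 2) (Fin 2) ℂ) * cf e.tgt *
          (((emlIterU (K - n) (bgUnits F K U₀) e)⁻¹ : (Matrix (Fin 2) (Fin 2) ℂ)ˣ) : Matrix (Fin 2) (Fin 2) ℂ)) →
        ∃ l₀ : Site (F.P K) 0 → Matrix (Fin 2) (Fin 2) ℂ,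
          (∀ b : PBond (F.P K) 0, l₀ b.src = ((bgUnits F K U₀ b : (Matrix (Fin 2) (Fin 2) ℂ)ˣ) : Matrix (Fin 2) (Fin 2) ℂ) * l₀ b.tgt * (((bgUnits F K U₀ b)⁻¹ : (Matrix (Fin 2) (Fin 2) ℂ)ˣ) : Matrix (Fin 2) (Fin 2) ℂ)) ∧
          ∀ y : Site (F.P K) (K - n), l₀ (embIter (K - n) y) = cf y)
    (c₁' : ℝ) (hc₁' : 0 < c₁') {a' : ℝ} (ha' : 0 < a') :
    ∀ X : PBond (F.P K) 0 → Matrix (Fin 2) (Fin 2) ℂ,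
      -((32 * Real.sqrt 2 * ε₀ * (((F.P K).d : ℝ) * (2 * 3) ^ (F.P K).d)
          + ((2 / ((1 + (25 / 8) * (c₁' * ((((F.P K).L : ℝ) ^ (F.P K).d) ^ (K - n))⁻¹ / c₀)) * (600 * (27 / 4 : ℝ) ^ 6 * (c₀ * ((F.L : ℝ) ^ 3) ^ (K - n) / c₁') + a'))) ^ 2 * a')⁻¹)
          * ‖toL2 F K c₀ X‖ ^ 2)
        ≤ RCLike.re ⟪toL2 F K c₀ X, laplaceA F n K h c₀ cB a (DeltaEtaSlot F n K c₀) U₀ (toL2 F K c₀ X)⟫_ℂ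
          - ∑ μ : Fin (F.P K).d, ‖DL2 F n K c₀ U₀ (toL2S F K c₀ (formComp X μ))‖ ^ 2 := by
  intro X
  have hloc := abs_re_inner_local_le F c₀ U₀ hε₀.le hreg X
  have hP := normSq_DstarL2_sub_RS_le_of_lift' F h c₀ cB hnK hε₀ hWε U₀ hreg hlift c₁' hc₁' ha' (toL2 F K c₀ X)
  have hk := katoEnergy_le (h := h) (cB := cB) (a := a) (Δx := DeltaEtaSlot F n K c₀) U₀ X hloc hP
  have hslot : RCLike.re ⟪toL2 F K c₀ X, (DeltaEtaSlot F n K c₀ U₀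
      - (DeltaEta F n K c₀ U₀ : BondL2K ℂ 3 (periodsT3 F K) c₀ W₂ →ₗ[ℂ] BondL2K ℂ 3 (periodsT3 F K) c₀ W₂)) (toL2 F K c₀ X)⟫_ℂ = 0 := by
    have h0 : DeltaEtaSlot F n K c₀ U₀
        - (DeltaEta F n K c₀ U₀ : BondL2K ℂ 3 (periodsT3 F K) c₀ W₂ →ₗ[ℂ] BondL2K ℂ 3 (periodsT3 F K) c₀ W₂) = 0 := sub_eq_zero.mpr rfl
    rw [h0, LinearMap.zero_apply, inner_zero_right, map_zero]
  have hq : 0 ≤ a * ‖Qk F n K h c₀ cB U₀ (toL2 F K c₀ X)‖ ^ 2 := by positivity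
  rw [hslot] at hk
  linarith

/-- ★★★ **(C_V) HOLDS WITH AN ABSOLUTE CONSTANT — the `hVlow` binder of A4b ✓`blockDecay_allBlocks_of_letters` ∕ (K2) ✓`kernelRow_GT_DeltaEtaSlot(_rate)` VERBATIM, letter-free
under `Lift`, uniformly in the coupling `a ≥ 0`**: at
`RegPr F n K ε₀ U₀` (`0 < ε₀`, `10¹²L³ε₀ ≤ 1`, `n < K`), `0 ≤ a`, `Lift`: for every bond field `X`,
`−(C_V·‖toL2 X‖²) ≤ re⟪toL2 X, laplaceA F n K h c₀ cB a (DeltaEtaSlot F n K c₀) U₀ (toL2 X)⟫ − Σ_μ ‖DL2 U₀ (toL2S (formComp X μ))‖²` with the K-FREE, COUPLING-FREE constant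
**`C_V := 32√2·ε₀·(d·6^d) + (33∕8)²·600·(27∕4)⁶`**.  Dock: `hVlow := hVlow_abs_of_lift F h c₀ cB hnK hε₀ hWε U₀ hreg ha hlift`.
[cite: Balaban1985Variational, (134)–(136) p.298; Balaban1985BackgroundPropagators, (3.26) p.395, Thm 3.11 p.416] -/
theorem hVlow_abs_of_lift (hnK : n < K) {ε₀ : ℝ} (hε₀ : 0 < ε₀) (hWε : 10 ^ 12 * (F.L : ℝ) ^ 3 * ε₀ ≤ 1)
    (U₀ : GaugeField (F.P K) 0 (Matrix.specialUnitaryGroup (Fin 2) ℂ)) (hreg : RegPr F n K ε₀ U₀) (ha : 0 ≤ a)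
    (hlift : ∀ cf : Site (F.P K) (K - n) → Matrix (Fin 2) (Fin 2) ℂ,
        (∀ e : PBond (F.P K) (K - n), cf e.src = ((emlIterU (K - n) (bgUnits F K U₀) e : (Matrix (Fin 2) (Fin 2) ℂ)ˣ) : Matrix (Fin 2) (Fin 2) ℂ) * cf e.tgt *
          (((emlIterU (K - n) (bgUnits F K U₀) e)⁻¹ : (Matrix (Fin 2) (Fin 2) ℂ)ˣ) : Matrix (Fin 2) (Fin 2) ℂ)) →
        ∃ l₀ : Site (F.P K) 0 → Matrix (Fin 2) (Fin 2) ℂ,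
          (∀ b : PBond (F.P K) 0, l₀ b.src = ((bgUnits F K U₀ b : (Matrix (Fin 2) (Fin 2) ℂ)ˣ) : Matrix (Fin 2) (Fin 2) ℂ) * l₀ b.tgt * (((bgUnits F K U₀ b)⁻¹ : (Matrix (Fin 2) (Fin 2) ℂ)ˣ) : Matrix (Fin 2) (Fin 2) ℂ)) ∧
          ∀ y : Site (F.P K) (K - n), l₀ (embIter (K - n) y) = cf y) :
    ∀ X : PBond (F.P K) 0 → Matrix (Fin 2) (Fin 2) ℂ,
      -((32 * Real.sqrt 2 * ε₀ * (((F.P K).d : ℝ) * (2 * 3) ^ (F.P K).d) + (33 / 8 : ℝ) ^ 2 * (600 * (27 / 4 : ℝ) ^ 6)) * ‖toL2 F K c₀ X‖ ^ 2)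
        ≤ RCLike.re ⟪toL2 F K c₀ X, laplaceA F n K h c₀ cB a (DeltaEtaSlot F n K c₀) U₀ (toL2 F K c₀ X)⟫_ℂ
          - ∑ μ : Fin (F.P K).d, ‖DL2 F n K c₀ U₀ (toL2S F K c₀ (formComp X μ))‖ ^ 2 := by
  intro X
  have hloc := abs_re_inner_local_le F c₀ U₀ hε₀.le hreg X
  have hP := normSq_DstarL2_sub_RS_le_of_lift F h c₀ cB hnK hε₀ hWε U₀ hreg hlift (toL2 F K c₀ X)
  have hk := katoEnergy_le (h := h) (cB := cB) (a := a) (Δx := DeltaEtaSlot F n K c₀) U₀ X hloc hP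
  have hslot : RCLike.re ⟪toL2 F K c₀ X, (DeltaEtaSlot F n K c₀ U₀
      - (DeltaEta F n K c₀ U₀ : BondL2K ℂ 3 (periodsT3 F K) c₀ W₂ →ₗ[ℂ] BondL2K ℂ 3 (periodsT3 F K) c₀ W₂)) (toL2 F K c₀ X)⟫_ℂ = 0 := by
    have h0 : DeltaEtaSlot F n K c₀ U₀
        - (DeltaEta F n K c₀ U₀ : BondL2K ℂ 3 (periodsT3 F K) c₀ W₂ →ₗ[ℂ] BondL2K ℂ 3 (periodsT3 F K) c₀ W₂) = 0 := sub_eq_zero.mpr rfl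
    rw [h0, LinearMap.zero_apply, inner_zero_right, map_zero]
  have hq : 0 ≤ a * ‖Qk F n K h c₀ cB U₀ (toL2 F K c₀ X)‖ ^ 2 := by positivity
  rw [hslot] at hk
  linarith

end Summit.QuantumFields.YangMills.Theorems.Prop7OneFormRemainderFloorOfLift

end
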